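import Summits.HodgeConjecture.HodgeConjecture.Theorems.H413PinCharacterTransport
import Summits.HodgeConjecture.HodgeConjecture.Theorems.H413FinCoeffNonvanishingAtSplitting
import Summits.HodgeConjecture.HodgeConjecture.Theorems.H413FinPairRepGramTransport
import Literature.NumberTheory.Automorphic.Liu2021.Def411ChiAutomorphicQuotient
import Literature.NumberTheory.GelbartRogawski1991.UnitaryDualPairThetaLiftGaussianCMLine
import HarnessLib

/-!
# FLOOR-0 P4, S4b — THE PIN CHARACTER `χ₂` OF `[U(⟨a⟩)]`: `χ₂([h]) = ĉ(1 ⊗ h)⁻¹ · χ_W(h_f)` (junction twist inverted times Liu's `χ` on the line)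

Cell hodgecm-mathlib (D-0151), FLOOR 0, crux item H413 = stmt-HodgeConjecture-24833; programme P4, line
`Cruxes/H413/Lines/F0_P4AdmissibleOccursInH1.lean` ED. 3.2, stub S4b `stub_T3a_holThetaAtAdmissibleLineOfRallisAt`; the `(χ)`+`(N)` row `hχN` of
F0P4-p01 (g2)'s closer `ThetaJunction.exists_holTheta_admissibleLine_of_chiN` (owner F0P4-p05).  Author F0P4-p05 (g2).
`--supports stmt-HodgeConjecture-24833` (helper).  DEF-FREE.  Namespace `Summit.HodgeConjecture.HodgeConjecture.Cruxes.H413.RallisTransport`.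

THE POINT.  The `(χ)`-row of `hχN` prescribes the finite character `χ₁ := (ĉ ∘ ι ∘ fin ∘ inr)⁻¹ · (lineChar a χ ∘ subgroupCongr⁻¹)` on
`U(⟨a⟩)(𝔸_f)` (`ĉ` the junction twist of ★ `exists_coinv_equiv_TW_splittingOf_adelic`: `s_μ = splittingOf hGR₀ ⊗ ĉ`; `χ ∈ Chi` the triple's
character), and ★ `RallisTransport.exists_chiRow_and_hne_of_pin_thetaLift_ne_zero` (p798140) produces BOTH rows for the model character `χ̃` read
off an AUTOMORPHIC character `χ₂` of `[U(⟨a⟩)] = U(⟨a⟩)(𝔸_{L⁺}) ⧸ U(⟨a⟩)(L⁺)` whose finite part is `χ₁`.  This file constructs that `χ₂`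
(existentially, as a `PontryaginDual` element — no definition): the product `ψ := (ĉ ∘ adelicInr)⁻¹ · (lineChar a χ ∘ subgroupCongr⁻¹ ∘ finPart)`
is a continuous character of `U(⟨a⟩)(𝔸_{L⁺})` (★ `continuous_adelicInr`, ★ `continuous_lineChar`, ★ `continuous_finPart`), UNITARY (the twist
factor by compactness of `[U(⟨a⟩)]` — ★ `ThetaNonvanishing.norm_eq_one_of_forall_range_eq_one`, ★ `compactSpace_quotient_range_toAdelic_line`;
Liu's factor by ★ `norm_lineChar_apply_eq_one`) and AUTOMORPHIC (`ĉ(1 ⊗ γ) = 1` is the junction's `hĉW`; `χ_W(γ_f) = χ(det γ) = 1` because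
`det γ_f` is the principal finite idèle of `det γ ∈ E¹` — `coe_finAdelicCenterInv_subgroupCongr_finPart_toAdelic`, the `diagonal (lineVec a)`-spelled
twin of ★ `coe_finAdelicCenterInv_finPart_toAdelic` — killed by `IsAutomorphicOneChar`), hence descends to the quotient; ★ N3
`exists_pontryaginDual_coe_eq` packages it.

* `coe_finAdelicCenterInv_subgroupCongr_finPart_toAdelic` — `det ((γ)_f) = (det γ)_f` for `γ ∈ U(⟨a⟩)(L⁺)` in the model's Gram spelling;
* **`exists_pinDual`** — `∃ χ₂ : PontryaginDual [U(⟨a⟩)], ∀ h, χ₂([h]) = (ĉ (adelicInr h))⁻¹ · lineChar a χ (subgroupCongr⁻¹ h_f)` (values in `ℂ`).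

HC_CM is proved only modulo the printed citations until rung 0 closes; this file proves nothing about them.

## References (conventions only; nothing of print is asserted)
* [Liu2021] Y. Liu, Camb. J. Math. 9 (2021) = arXiv:2102.11518, Def. 4.11 (l. 2090); App. D §D.1 Step 3 (l. 5221); proof of Prop. 4.13 (l. 2145).
* [GelbartRogawski1991] S. Gelbart, J. Rogawski, Invent. Math. 105 (1991), §3.1 Remark p. 457 L4–13.
* [Mok2014] C. P. Mok, Mem. AMS 235 (2015), §1 Notation p. 5 (the centre `E¹ · 1_N`, `det` on `U(1)`).
-/

set_option autoImplicit false
set_option linter.dupNamespace false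

noncomputable section

open NumberField IsDedekindDomain
open scoped Matrix ComplexConjugate
open Literature.NumberTheory.Automorphic Literature.NumberTheory.Automorphic.UnitaryGroup
open Literature.NumberTheory.GelbartRogawski1991 Literature.NumberTheory.GelbartRogawski1991.UnitaryDualPair
open Literature.NumberTheory.Automorphic.Liu2021.Def411WeilCarriers (Chi JW lineChar lineChar_eq_apply_finAdelicCenterInv
  continuous_lineChar norm_lineChar_apply_eq_one JW_apply_ne_zero)
open Summit.HodgeConjecture.HodgeConjecture.Cruxes.H413.ThetaJunction (finAdelic_JW_eq complexConj_lineVec_coe lineVec_coe_ne_zero)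
open Summit.HodgeConjecture.HodgeConjecture.Cruxes.H413.ThetaNonvanishing (norm_eq_one_of_forall_range_eq_one)

namespace Summit.HodgeConjecture.HodgeConjecture.Cruxes.H413.RallisTransport

section PinDual

variable (L : Type) [Field L] [NumberField L] [IsCMField L] {N : ℕ} (JV : Matrix (Fin N) (Fin N) L)
  (a : (↥(maximalRealSubfield L))ˣ)
  (ĉ : ↥(UnitaryGroup.adelicPair (↥(maximalRealSubfield L)) L (IsCMField.complexConj L) N 1 JV
      (Matrix.diagonal (lineVec L ((a : ↥(maximalRealSubfield L)) : L)))) →* ℂˣ)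
  (hĉW : ∀ γ ∈ (UnitaryGroup.toAdelic (↥(maximalRealSubfield L)) L (IsCMField.complexConj L) 1
      (Matrix.diagonal (lineVec L ((a : ↥(maximalRealSubfield L)) : L)))).range,
    ĉ (UnitaryGroup.adelicInr (↥(maximalRealSubfield L)) L (IsCMField.complexConj L) N 1 JV
      (Matrix.diagonal (lineVec L ((a : ↥(maximalRealSubfield L)) : L))) γ) = 1)
  (hĉc : Continuous ĉ)
  (χ : Chi (↥(maximalRealSubfield L)) L (IsCMField.complexConj L))

/-- the determinant of the finite part of a rational point of the line `⟨a⟩` (spelling `diagonal (lineVec a)`, moved to the spelling `J_W a` by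
`subgroupCongr`) is the principal finite idèle of its entry. [cite: Mok2014, §1 Notation p. 5] -/
theorem coe_finAdelicCenterInv_subgroupCongr_finPart_toAdelic
    (γ : UnitaryGroup.rational (↥(maximalRealSubfield L)) L (IsCMField.complexConj L) 1
      (Matrix.diagonal (lineVec L ((a : ↥(maximalRealSubfield L)) : L)))) :
    ((UnitaryGroup.finAdelicCenterInv (↥(maximalRealSubfield L)) L (IsCMField.complexConj L) (JW (↥(maximalRealSubfield L)) L a)
        (JW_apply_ne_zero (↥(maximalRealSubfield L)) L a)
        ((MulEquiv.subgroupCongr (finAdelic_JW_eq L a)).symm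
          (UnitaryGroup.finPart (↥(maximalRealSubfield L)) L (IsCMField.complexConj L) 1
            (Matrix.diagonal (lineVec L ((a : ↥(maximalRealSubfield L)) : L)))
            (UnitaryGroup.toAdelic (↥(maximalRealSubfield L)) L (IsCMField.complexConj L) 1
              (Matrix.diagonal (lineVec L ((a : ↥(maximalRealSubfield L)) : L))) γ))) :
          UnitaryGroup.finAdelicOne (↥(maximalRealSubfield L)) L (IsCMField.complexConj L)) : (FiniteAdeleRing (𝓞 L) L)ˣ) =
      Units.map (algebraMap L (FiniteAdeleRing (𝓞 L) L)).toMonoidHom (Matrix.GeneralLinearGroup.det (γ : GL (Fin 1) L)) := by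
  refine Units.ext ?_
  rw [UnitaryGroup.coe_finAdelicCenterInv, Matrix.GeneralLinearGroup.val_det_apply, Matrix.det_fin_one, Units.coe_map]
  change _ = algebraMap L (FiniteAdeleRing (𝓞 L) L) ((Matrix.GeneralLinearGroup.det (γ : GL (Fin 1) L) : Lˣ) : L)
  rw [Matrix.GeneralLinearGroup.val_det_apply, Matrix.det_fin_one]
  rfl

include hĉW hĉc in
/-- **THE PIN CHARACTER `χ₂` OF `[U(⟨a⟩)]`** — the continuous unitary character of `U(⟨a⟩)(𝔸_{L⁺}) ⧸ U(⟨a⟩)(L⁺)` with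
`χ₂([h]) = ĉ(1 ⊗ h)⁻¹ · χ_W(h_f)`: the junction twist `ĉ` (automorphic on the line by `hĉW`, continuous, hence unitary on the compact quotient — ★
`norm_eq_one_of_forall_range_eq_one`) inverted, times Liu's `χ` read on the line (`χ_W = χ ∘ det`, automorphic by `IsAutomorphicOneChar`, unitary ★
`norm_lineChar_apply_eq_one`, trivial at `∞`).  Existence as a `PontryaginDual` element by ★ `exists_pontryaginDual_coe_eq`.
[cite: Liu2021, Def. 4.11 (l. 2090); App. D §D.1 Step 3 (l. 5221)] [cite: GelbartRogawski1991, §3.1 Remark p. 457 L4–13] -/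
theorem exists_pinDual [(CMRat L (lineVec L ((a : ↥(maximalRealSubfield L)) : L))).Normal] :
    ∃ χ₂ : PontryaginDual (CMAdelic L (lineVec L ((a : ↥(maximalRealSubfield L)) : L)) ⧸ CMRat L (lineVec L ((a : ↥(maximalRealSubfield L)) : L))),
      ∀ h : CMAdelic L (lineVec L ((a : ↥(maximalRealSubfield L)) : L)),
        ((χ₂ (QuotientGroup.mk h) : Circle) : ℂ) =
          (((ĉ (UnitaryGroup.adelicInr (↥(maximalRealSubfield L)) L (IsCMField.complexConj L) N 1 JV
              (Matrix.diagonal (lineVec L ((a : ↥(maximalRealSubfield L)) : L))) h))⁻¹ *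
            lineChar (↥(maximalRealSubfield L)) L (IsCMField.complexConj L) a χ.1
              ((MulEquiv.subgroupCongr (finAdelic_JW_eq L a)).symm
                (UnitaryGroup.finPart (↥(maximalRealSubfield L)) L (IsCMField.complexConj L) 1
                  (Matrix.diagonal (lineVec L ((a : ↥(maximalRealSubfield L)) : L))) h)) : ℂˣ) : ℂ) := by
  -- the two factors as homomorphisms
  set ĉW : CMAdelic L (lineVec L ((a : ↥(maximalRealSubfield L)) : L)) →* ℂˣ :=
    ĉ.comp (UnitaryGroup.adelicInr (↥(maximalRealSubfield L)) L (IsCMField.complexConj L) N 1 JV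
      (Matrix.diagonal (lineVec L ((a : ↥(maximalRealSubfield L)) : L)))) with hĉW_def
  set χW : CMAdelic L (lineVec L ((a : ↥(maximalRealSubfield L)) : L)) →* ℂˣ :=
    (lineChar (↥(maximalRealSubfield L)) L (IsCMField.complexConj L) a χ.1).comp
      ((MulEquiv.subgroupCongr (finAdelic_JW_eq L a)).symm.toMonoidHom.comp
        (UnitaryGroup.finPart (↥(maximalRealSubfield L)) L (IsCMField.complexConj L) 1
          (Matrix.diagonal (lineVec L ((a : ↥(maximalRealSubfield L)) : L))))) with hχW_def
  set ψ : CMAdelic L (lineVec L ((a : ↥(maximalRealSubfield L)) : L)) →* ℂˣ := ĉW⁻¹ * χW with hψ_def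
  have hψ_apply : ∀ h, ψ h = (ĉ (UnitaryGroup.adelicInr (↥(maximalRealSubfield L)) L (IsCMField.complexConj L) N 1 JV
      (Matrix.diagonal (lineVec L ((a : ↥(maximalRealSubfield L)) : L))) h))⁻¹ *
        lineChar (↥(maximalRealSubfield L)) L (IsCMField.complexConj L) a χ.1
          ((MulEquiv.subgroupCongr (finAdelic_JW_eq L a)).symm
            (UnitaryGroup.finPart (↥(maximalRealSubfield L)) L (IsCMField.complexConj L) 1
              (Matrix.diagonal (lineVec L ((a : ↥(maximalRealSubfield L)) : L))) h)) := fun h => rfl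
  -- continuity
  have hĉWc : Continuous fun h => ((ĉW h : ℂˣ) : ℂ) :=
    Units.continuous_val.comp (hĉc.comp (UnitaryGroup.continuous_adelicInr _ _ _ _ _ _ _))
  have hcongr : Continuous (MulEquiv.subgroupCongr (finAdelic_JW_eq L a)).symm :=
    Continuous.subtype_mk continuous_subtype_val _
  have hχWc : Continuous fun h => ((χW h : ℂˣ) : ℂ) :=
    Units.continuous_val.comp (((continuous_lineChar _ _ _ a χ.2.1).comp hcongr).comp
      (UnitaryGroup.continuous_finPart _ _ _ _ _))
  have hψc : Continuous fun h => ((ψ h : ℂˣ) : ℂ) := by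
    have : (fun h => ((ψ h : ℂˣ) : ℂ)) = fun h => ((ĉW h : ℂˣ) : ℂ)⁻¹ * ((χW h : ℂˣ) : ℂ) := by
      funext h
      rw [hψ_def, MonoidHom.mul_apply, MonoidHom.inv_apply, Units.val_mul, Units.val_inv_eq_inv_val]
    rw [this]
    exact (hĉWc.inv₀ fun h => Units.ne_zero _).mul hχWc
  -- unitarity
  haveI : CompactSpace (CMAdelic L (lineVec L ((a : ↥(maximalRealSubfield L)) : L)) ⧸ CMRat L (lineVec L ((a : ↥(maximalRealSubfield L)) : L))) :=
    compactSpace_quotient_range_toAdelic_line L (lineVec L ((a : ↥(maximalRealSubfield L)) : L)) (complexConj_lineVec_coe L a)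
      (lineVec_coe_ne_zero L a)
  have hĉW1 : ∀ h, ‖((ĉW h : ℂˣ) : ℂ)‖ = 1 :=
    norm_eq_one_of_forall_range_eq_one (CMRat L (lineVec L ((a : ↥(maximalRealSubfield L)) : L))) ĉW hĉWc
      (fun γ hγ => hĉW γ hγ)
  have hχW1 : ∀ h, ‖((χW h : ℂˣ) : ℂ)‖ = 1 := fun h =>
    norm_lineChar_apply_eq_one _ L _ (Algebra.IsQuadraticExtension.finrank_eq_two _ L) (IsCMField.complexConj_ne_one (K := L)) a χ _
  have hψ1 : ∀ h, ‖((ψ h : ℂˣ) : ℂ)‖ = 1 := fun h => by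
    rw [hψ_def, MonoidHom.mul_apply, MonoidHom.inv_apply, Units.val_mul, Units.val_inv_eq_inv_val, norm_mul, norm_inv, hĉW1, hχW1,
      inv_one, one_mul]
  -- automorphy: `ψ` kills `U(⟨a⟩)(L⁺)`
  have hker : CMRat L (lineVec L ((a : ↥(maximalRealSubfield L)) : L)) ≤ ψ.ker := by
    rintro _ ⟨γ, rfl⟩
    rw [MonoidHom.mem_ker, hψ_def, MonoidHom.mul_apply, MonoidHom.inv_apply]
    have h1 : ĉW (UnitaryGroup.toAdelic _ L _ 1 _ γ) = 1 := hĉW _ ⟨γ, rfl⟩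
    have h2 : χW (UnitaryGroup.toAdelic _ L _ 1 _ γ) = 1 := by
      have step : χW (UnitaryGroup.toAdelic _ L _ 1 _ γ) =
          χ.1 (UnitaryGroup.finAdelicCenterInv _ L _ (JW (↥(maximalRealSubfield L)) L a) (JW_apply_ne_zero _ L a)
            ((MulEquiv.subgroupCongr (finAdelic_JW_eq L a)).symm
              (UnitaryGroup.finPart (↥(maximalRealSubfield L)) L (IsCMField.complexConj L) 1
                (Matrix.diagonal (lineVec L ((a : ↥(maximalRealSubfield L)) : L)))
                (UnitaryGroup.toAdelic _ L _ 1 _ γ)))) :=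
        lineChar_eq_apply_finAdelicCenterInv _ _ _ a χ.1 _
      have hval := coe_finAdelicCenterInv_subgroupCongr_finPart_toAdelic L a γ
      have hx : Units.map (algebraMap L (FiniteAdeleRing (𝓞 L) L)).toMonoidHom
          (Matrix.GeneralLinearGroup.det (γ : GL (Fin 1) L)) ∈ UnitaryGroup.finAdelicOne (↥(maximalRealSubfield L)) L (IsCMField.complexConj L) :=
        hval ▸ (UnitaryGroup.finAdelicCenterInv _ L _ (JW (↥(maximalRealSubfield L)) L a) (JW_apply_ne_zero _ L a) _).2
      have heq : UnitaryGroup.finAdelicCenterInv _ L _ (JW (↥(maximalRealSubfield L)) L a) (JW_apply_ne_zero _ L a)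
          ((MulEquiv.subgroupCongr (finAdelic_JW_eq L a)).symm
            (UnitaryGroup.finPart (↥(maximalRealSubfield L)) L (IsCMField.complexConj L) 1
              (Matrix.diagonal (lineVec L ((a : ↥(maximalRealSubfield L)) : L)))
              (UnitaryGroup.toAdelic _ L _ 1 _ γ))) = ⟨_, hx⟩ :=
        Subtype.ext hval
      exact step.trans ((congrArg χ.1 heq).trans (χ.2.2 _ hx))
    rw [h1, h2, inv_one, one_mul]
  -- descend to the quotient and package as a Pontryagin-dual element
  let ψq : CMAdelic L (lineVec L ((a : ↥(maximalRealSubfield L)) : L)) ⧸ CMRat L (lineVec L ((a : ↥(maximalRealSubfield L)) : L)) →* ℂˣ :=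
    QuotientGroup.lift _ ψ hker
  have hψqc : Continuous fun q => ((ψq q : ℂˣ) : ℂ) := by
    rw [(QuotientGroup.isQuotientMap_mk _).continuous_iff]
    exact hψc
  obtain ⟨χ₂, hχ₂⟩ := exists_pontryaginDual_coe_eq ⟨fun q => ((ψq q : ℂˣ) : ℂ), hψqc⟩
    (by simp only [ContinuousMap.coe_mk, map_one, Units.val_one])
    (fun x y => by simp only [ContinuousMap.coe_mk, map_mul, Units.val_mul])
    (fun q => by
      induction q using QuotientGroup.induction_on with
      | H h => simp only [ContinuousMap.coe_mk, ψq, QuotientGroup.lift_mk]; exact hψ1 h)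
  refine ⟨χ₂, fun h => ?_⟩
  rw [hχ₂, ContinuousMap.coe_mk]
  show ((QuotientGroup.lift _ ψ hker (QuotientGroup.mk h) : ℂˣ) : ℂ) = _
  rw [QuotientGroup.lift_mk, hψ_apply]

end PinDual

end Summit.HodgeConjecture.HodgeConjecture.Cruxes.H413.RallisTransport

end
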